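import Summits.FinalStateConjecture.FinalStateConjecture.Theorems.ClusterCompletenessAdiabaticMultiKerrILEDFarBounds

/-!
# Crux `AdiabaticMultiKerrILED` (line `Sketch`) — pointwise bound of the far-field cut-off error

Helper file for the far-field Morawetz transport stub `stub_farTransport` of the line `Sketch`
(crux item `stmt-FinalStateConjecture-14310`, route `ClusterCompleteness`), companion of
`…FarBounds.lean` (`abs_farCurrent_le`): the error term produced by cutting the flat Morawetz pair
`(X_g, ϖ)` off with the zone cut-off `ζ` (see `far_divergence_eq`),
`Err = ∑_μ (J^{X_g})^μ ∂_μζ − ⅛ (2 ∑ η^{μν} ∂_μζ ∂_ν(ϖ∘s) + ϖ(s) □_η ζ) w²`,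
obeys `|Err| ≤ 18 ‖dζ‖ ∑(∂w)² + (32 ‖dζ‖/(|x⃗|+R)² + 4 ‖d²ζ‖/(|x⃗|+R)) w²` (`abs_farError_le`,
registered sub-goal), using the flat bounds `|g| |x⃗| ≤ 1`, `|ϖ| (|x⃗|+R) ≤ 8`, `‖d(ϖ∘s)‖ (|x⃗|+R)² ≤ 32`.
-/

noncomputable section

-- the doubled `FinalStateConjecture.FinalStateConjecture` path component trips dupNamespace
set_option linter.dupNamespace false

open scoped ContDiff Topology
open Filter Set Literature.Geometry.Lorentzian Literature.Geometry.Lorentzian.KerrSchild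

namespace Summit.FinalStateConjecture.FinalStateConjecture.Cruxes.AdiabaticMultiKerrILED.Sketch

/-! ### Pointwise bounds for the cut-off far current -/

section FarError

/-- `|∑_{μν} η^{μν} a_μ b_ν| ≤ ∑_μ |a_μ| |b_μ|` for the Minkowski coefficients. [folklore] -/
theorem abs_sum_sum_etaComp_mul_le (a b : Fin 4 → ℝ) :
    |∑ μ, ∑ ν, Kerr.etaComp μ ν * a μ * b ν| ≤ ∑ μ, |a μ| * |b μ| := by
  simp only [etaComp_eq, Fin.sum_univ_four, Fin.isValue]
  simp only [show (1 : Fin 4) ≠ 0 from by decide, show (2 : Fin 4) ≠ 0 from by decide,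
    show (3 : Fin 4) ≠ 0 from by decide, show (0 : Fin 4) ≠ 1 from by decide,
    show (0 : Fin 4) ≠ 2 from by decide, show (0 : Fin 4) ≠ 3 from by decide,
    show (1 : Fin 4) ≠ 2 from by decide, show (1 : Fin 4) ≠ 3 from by decide,
    show (2 : Fin 4) ≠ 1 from by decide, show (2 : Fin 4) ≠ 3 from by decide,
    show (3 : Fin 4) ≠ 1 from by decide, show (3 : Fin 4) ≠ 2 from by decide, if_true, if_false]
  simp only [zero_mul, add_zero, zero_add, one_mul, neg_mul]
  have h0 := abs_mul (a 0) (b 0); have h1 := abs_mul (a 1) (b 1)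
  have h2 := abs_mul (a 2) (b 2); have h3 := abs_mul (a 3) (b 3)
  calc |-(a 0 * b 0) + a 1 * b 1 + a 2 * b 2 + a 3 * b 3|
      ≤ |-(a 0 * b 0) + a 1 * b 1 + a 2 * b 2| + |a 3 * b 3| := abs_add_le _ _
    _ ≤ |-(a 0 * b 0) + a 1 * b 1| + |a 2 * b 2| + |a 3 * b 3| := by gcongr; exact abs_add_le _ _
    _ ≤ |-(a 0 * b 0)| + |a 1 * b 1| + |a 2 * b 2| + |a 3 * b 3| := by gcongr; exact abs_add_le _ _
    _ = |a 0| * |b 0| + |a 1| * |b 1| + |a 2| * |b 2| + |a 3| * |b 3| := by rw [abs_neg, h0, h1, h2, h3]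

/-- **Pointwise bound for the cut-off error term** of `far_divergence_eq`:
`|∑_μ (J^{X_g})^μ ∂_μζ − ⅛ (2 η(dζ, d(ϖ∘s)) + ϖ □_η ζ) w²|
   ≤ 18 ‖dζ‖ ∑p² + (32 ‖dζ‖/(√s + R)² + 4 ‖d²ζ‖/(√s + R)) w²` (`ζ` of class `C²` at the point). [folklore] -/
theorem abs_farError_le {g ϖ : ℝ → ℝ} {R : ℝ} (hR : 0 < R)
    (hgb : ∀ y : E4, |g (E4.spatialNorm y ^ 2)| * E4.spatialNorm y ≤ 1)
    (hϖb : ∀ y : E4, |ϖ (E4.spatialNorm y ^ 2)| * (E4.spatialNorm y + R) ≤ 8)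
    (hdϖb : ∀ y : E4, ‖fderiv ℝ (fun z : E4 ↦ ϖ (E4.spatialNorm z ^ 2)) y‖ * (E4.spatialNorm y + R) ^ 2 ≤ 32)
    {ζ : E4 → ℝ} {x : E4} (hζ2 : ContDiffAt ℝ 2 ζ x) (w : E4 → ℝ) :
    |(∑ μ, multiplierCurrent (fun _ ↦ Kerr.etaComp)
          (fun z α ↦ if α = 0 then (0 : ℝ) else g (E4.spatialNorm z ^ 2) * z α) w x μ *
          fderiv ℝ ζ x (E4.basisVector μ)) -
        8⁻¹ * (2 * (∑ μ, ∑ ν, Kerr.etaComp μ ν * fderiv ℝ ζ x (E4.basisVector μ) *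
          fderiv ℝ (fun z : E4 ↦ ϖ (E4.spatialNorm z ^ 2)) x (E4.basisVector ν)) +
          ϖ (E4.spatialNorm x ^ 2) * waveOperator (fun _ ↦ Kerr.etaComp) ζ x) * w x ^ 2| ≤
      18 * ‖fderiv ℝ ζ x‖ * (∑ κ, (fderiv ℝ w x (E4.basisVector κ)) ^ 2) +
        (32 * ‖fderiv ℝ ζ x‖ / (E4.spatialNorm x + R) ^ 2 +
          4 * ‖fderiv ℝ (fderiv ℝ ζ) x‖ / (E4.spatialNorm x + R)) * w x ^ 2 := by
  set P := ∑ κ, (fderiv ℝ w x (E4.basisVector κ)) ^ 2 with hP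
  set r := E4.spatialNorm x with hr
  set Dζ := ‖fderiv ℝ ζ x‖ with hDζ
  set D2 := ‖fderiv ℝ (fderiv ℝ ζ) x‖ with hD2
  have hr0 : 0 ≤ r := E4.spatialNorm_nonneg x
  have hrR : 0 < r + R := by linarith
  have hPnn : 0 ≤ P := Finset.sum_nonneg fun _ _ ↦ sq_nonneg _
  have hDζ0 : 0 ≤ Dζ := norm_nonneg (fderiv ℝ ζ x)
  have hD20 : 0 ≤ D2 := norm_nonneg (fderiv ℝ (fderiv ℝ ζ) x)
  have hdζ : ∀ μ, |fderiv ℝ ζ x (E4.basisVector μ)| ≤ Dζ := fun μ ↦ abs_fderiv_apply_basisVector_le ζ x μ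
  -- the transport term
  have hXg : ∑ α, |(if α = 0 then (0 : ℝ) else g (E4.spatialNorm x ^ 2) * x α)| ≤ 3 := by
    have := sum_abs_cutoff_radial_le hgb (ζ := fun _ ↦ (1 : ℝ)) (x := x) zero_le_one
    simpa using this
  have hJ : ∀ μ, |multiplierCurrent (fun _ ↦ Kerr.etaComp)
      (fun z α ↦ if α = 0 then (0 : ℝ) else g (E4.spatialNorm z ^ 2) * z α) w x μ| ≤ 9 / 2 * P := by
    intro μ
    refine (abs_multiplierCurrent_eta_le _ w x μ).trans ?_
    calc 3 / 2 * (∑ α, |(if α = 0 then (0 : ℝ) else g (E4.spatialNorm x ^ 2) * x α)|) * P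
        ≤ 3 / 2 * 3 * P := by gcongr
      _ = 9 / 2 * P := by ring
  have hT : |∑ μ, multiplierCurrent (fun _ ↦ Kerr.etaComp)
      (fun z α ↦ if α = 0 then (0 : ℝ) else g (E4.spatialNorm z ^ 2) * z α) w x μ *
      fderiv ℝ ζ x (E4.basisVector μ)| ≤ 18 * Dζ * P := by
    calc |∑ μ, multiplierCurrent (fun _ ↦ Kerr.etaComp)
          (fun z α ↦ if α = 0 then (0 : ℝ) else g (E4.spatialNorm z ^ 2) * z α) w x μ *
          fderiv ℝ ζ x (E4.basisVector μ)|
        ≤ ∑ μ, |multiplierCurrent (fun _ ↦ Kerr.etaComp)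
          (fun z α ↦ if α = 0 then (0 : ℝ) else g (E4.spatialNorm z ^ 2) * z α) w x μ *
          fderiv ℝ ζ x (E4.basisVector μ)| := Finset.abs_sum_le_sum_abs _ _
      _ ≤ ∑ _μ : Fin 4, 9 / 2 * P * Dζ := Finset.sum_le_sum fun μ _ ↦ by
          rw [abs_mul]
          exact mul_le_mul (hJ μ) (hdζ μ) (abs_nonneg _) (by positivity)
      _ = 18 * Dζ * P := by simp; ring
  -- the cross term
  have hdϖ : ∀ μ, |fderiv ℝ (fun z : E4 ↦ ϖ (E4.spatialNorm z ^ 2)) x (E4.basisVector μ)| ≤ 32 / (r + R) ^ 2 := by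
    intro μ
    rw [le_div_iff₀ (by positivity)]
    calc |fderiv ℝ (fun z : E4 ↦ ϖ (E4.spatialNorm z ^ 2)) x (E4.basisVector μ)| * (r + R) ^ 2
        ≤ ‖fderiv ℝ (fun z : E4 ↦ ϖ (E4.spatialNorm z ^ 2)) x‖ * (r + R) ^ 2 :=
          mul_le_mul_of_nonneg_right (abs_fderiv_apply_basisVector_le _ x μ) (by positivity)
      _ ≤ 32 := hdϖb x
  have hC : |∑ μ, ∑ ν, Kerr.etaComp μ ν * fderiv ℝ ζ x (E4.basisVector μ) *
      fderiv ℝ (fun z : E4 ↦ ϖ (E4.spatialNorm z ^ 2)) x (E4.basisVector ν)| ≤ 4 * Dζ * (32 / (r + R) ^ 2) := by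
    refine (abs_sum_sum_etaComp_mul_le _ _).trans ?_
    calc ∑ μ, |fderiv ℝ ζ x (E4.basisVector μ)| * |fderiv ℝ (fun z : E4 ↦ ϖ (E4.spatialNorm z ^ 2)) x (E4.basisVector μ)|
        ≤ ∑ _μ : Fin 4, Dζ * (32 / (r + R) ^ 2) := Finset.sum_le_sum fun μ _ ↦
          mul_le_mul (hdζ μ) (hdϖ μ) (abs_nonneg _) hDζ0
      _ = 4 * Dζ * (32 / (r + R) ^ 2) := by simp; ring
  -- the `ϖ □ζ` term
  have hϖabs : |ϖ (E4.spatialNorm x ^ 2)| ≤ 8 / (r + R) := by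
    rw [le_div_iff₀ hrR]; exact hϖb x
  have hW : |ϖ (E4.spatialNorm x ^ 2) * waveOperator (fun _ ↦ Kerr.etaComp) ζ x| ≤ (8 / (r + R)) * (4 * D2) := by
    rw [abs_mul]
    exact mul_le_mul hϖabs (abs_waveOperator_eta_le hζ2) (abs_nonneg _) (by positivity)
  -- combine
  have hw2 : 0 ≤ w x ^ 2 := sq_nonneg _
  calc |(∑ μ, multiplierCurrent (fun _ ↦ Kerr.etaComp)
          (fun z α ↦ if α = 0 then (0 : ℝ) else g (E4.spatialNorm z ^ 2) * z α) w x μ *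
          fderiv ℝ ζ x (E4.basisVector μ)) -
        8⁻¹ * (2 * (∑ μ, ∑ ν, Kerr.etaComp μ ν * fderiv ℝ ζ x (E4.basisVector μ) *
          fderiv ℝ (fun z : E4 ↦ ϖ (E4.spatialNorm z ^ 2)) x (E4.basisVector ν)) +
          ϖ (E4.spatialNorm x ^ 2) * waveOperator (fun _ ↦ Kerr.etaComp) ζ x) * w x ^ 2|
      ≤ |∑ μ, multiplierCurrent (fun _ ↦ Kerr.etaComp)
          (fun z α ↦ if α = 0 then (0 : ℝ) else g (E4.spatialNorm z ^ 2) * z α) w x μ *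
          fderiv ℝ ζ x (E4.basisVector μ)| +
        |8⁻¹ * (2 * (∑ μ, ∑ ν, Kerr.etaComp μ ν * fderiv ℝ ζ x (E4.basisVector μ) *
          fderiv ℝ (fun z : E4 ↦ ϖ (E4.spatialNorm z ^ 2)) x (E4.basisVector ν)) +
          ϖ (E4.spatialNorm x ^ 2) * waveOperator (fun _ ↦ Kerr.etaComp) ζ x) * w x ^ 2| := abs_sub _ _
    _ ≤ 18 * Dζ * P + 8⁻¹ * (2 * (4 * Dζ * (32 / (r + R) ^ 2)) + (8 / (r + R)) * (4 * D2)) * w x ^ 2 := by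
        refine add_le_add hT ?_
        · rw [abs_mul, abs_mul, abs_of_pos (by norm_num : (0 : ℝ) < 8⁻¹), abs_of_nonneg hw2]
          gcongr
          calc |2 * (∑ μ, ∑ ν, Kerr.etaComp μ ν * fderiv ℝ ζ x (E4.basisVector μ) *
                fderiv ℝ (fun z : E4 ↦ ϖ (E4.spatialNorm z ^ 2)) x (E4.basisVector ν)) +
                ϖ (E4.spatialNorm x ^ 2) * waveOperator (fun _ ↦ Kerr.etaComp) ζ x|
              ≤ |2 * (∑ μ, ∑ ν, Kerr.etaComp μ ν * fderiv ℝ ζ x (E4.basisVector μ) *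
                  fderiv ℝ (fun z : E4 ↦ ϖ (E4.spatialNorm z ^ 2)) x (E4.basisVector ν))| +
                |ϖ (E4.spatialNorm x ^ 2) * waveOperator (fun _ ↦ Kerr.etaComp) ζ x| := abs_add_le _ _
            _ ≤ 2 * (4 * Dζ * (32 / (r + R) ^ 2)) + (8 / (r + R)) * (4 * D2) := by
                rw [abs_mul, abs_two]
                gcongr
    _ = 18 * Dζ * P + (32 * Dζ / (r + R) ^ 2 + 4 * D2 / (r + R)) * w x ^ 2 := by
        field_simp
        ring

end FarError

end Summit.FinalStateConjecture.FinalStateConjecture.Cruxes.AdiabaticMultiKerrILED.Sketch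

end
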